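import Summits.AtomisticToContinuum.Crystallization.Theorems.FreeSplittingCertificatesStrictSplittingRuleTorusModel442Defs
import Literature.Computation.Certificates.PosSemidefDecide

/-!
# Torus model 4×4×2: the co-rotation `W_p(u)` of the model IS the least-squares skew fit (first clause of `CoreJointSiteIneq`)

Route `FreeSplittingCertificates`, crux `StrictSplittingRule` (stmt-AtomisticToContinuum-12560); unit b2b-freesplit-B (block 2b,
PART B, gen 1).  VALUE = fidelity of a FINITE model — NOT summit progress.

`CoreJointSiteIneq` evaluates the demand's `κ₃`-term, the co-rotated prestress and the readout form in p's LEAST-SQUARES chart: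
`W` is a `G`-skew map minimising `Σ_{s ∈ shell(p)} ‖(u_{p+s} − u_p) − W·(y_{p+s} − y_p)‖²` among all skew maps.  In the Lean model
(`…TorusModel442Defs.lean`) `W_p(u)·y = G⁻¹ (Σ_k θ_k(u) E_k) y` with `θ(u) = J⁻¹ Σ_s C_sᵀ e_s(u)` (`theta`, `thetaList`, `Wy`), the
solution of the normal equations.  This file PROVES, for both reference sites, that this `θ(u)` is optimal: for every
displacement field `u : Fin 192 → ℚ` and every rotation parameter `θ' : Fin 3 → ℚ` (every `G`-skew map is `G⁻¹ Σ_k θ'_k E_k`),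
`Σ_s Σ_c g_c (u_{p+s} − u_p − W_p(u) V s)_c² ≤ Σ_s Σ_c g_c (u_{p+s} − u_p − G⁻¹ C_{V s} θ')_c²`
(`shellMisfit_le_A/B`).  Method: both sides are quadratic forms in the 195 variables `(u, θ')`; the difference is assembled
with the verified sparse-Gram machinery of `…TorusQForm.lean` and certified positive SEMIdefinite by the exact in-Lean `LDLᵀ`
`PSD.LDLCert` (`Literature/Computation/Certificates/PosSemidefDecide.lean`; rank 3, exact rationals), one `native_decide` per
parity (COMPUTATIONAL regime, `Lean.ofReduceBool`).
-/

namespace Summit.AtomisticToContinuum.Crystallization.Theorems.StrictSplittingRuleTorusLMI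

open Literature.Computation.Certificates

/-! ## Glue for exact `LDLᵀ` certificates (any dimension) -/

/-- Negate the weights of a term list (generic dimension). [folklore] -/
def negTermsN {N : ℕ} (ts : List (Term N)) : List (Term N) := ts.map fun t => (-t.1, t.2)

/-- `evalQ (negTermsN ts) = −evalQ ts`. [folklore] -/
theorem evalQ_negTermsN {N : ℕ} (ts : List (Term N)) (u : Fin N → ℚ) : evalQ (negTermsN ts) u = -evalQ ts u := by
  induction ts with
  | nil => simp [negTermsN]
  | cons t ts ih => simp only [negTermsN, List.map_cons, evalQ_cons] at ih ⊢; rw [ih]; ring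

/-- Glue: an exact in-Lean `LDLᵀ` certificate (`PSD.LDLCert`) of the symmetrised assembled matrix makes the term-list form
nonnegative. [folklore] -/
theorem evalQ_nonneg_of_ldlCert {N : ℕ} {ts : List (Term N)} {A : Matrix (Fin N) (Fin N) ℚ}
    (hA : A = symm (assemble ts).toMatrix) (h : PSD.LDLCert A) (u : Fin N → ℚ) : 0 ≤ evalQ ts u := by
  have h0 := h.quadForm_nonneg (R := ℚ) u
  simp only [Rat.cast_id] at h0
  rw [hA, quadForm_symm, toMatrix_assemble, ← evalQ_eq_quadForm] at h0
  exact h0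

/-! ## The 195 variables `(u, θ')` -/

/-- Embed a functional of `u` into the variables `(u, θ')`. [folklore] -/
def embedU (ℓ : LinF 192) : LinF 195 := ℓ.map fun p => (Fin.castLE (by omega) p.1, p.2)

/-- The free rotation parameter `θ'_k` = variable `192 + k`. [folklore] -/
def thetaVar (k : Fin 3) : LinF 195 := LinF.coord ⟨192 + k.val, by omega⟩

/-- Join `u` and `θ'` into one variable vector. [folklore] -/
def joinUT (u : Fin 192 → ℚ) (θ' : Fin 3 → ℚ) : Fin 195 → ℚ :=
  fun i => if h : i.val < 192 then u ⟨i.val, h⟩ else θ' ⟨i.val - 192, by omega⟩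

/-- `embedU ℓ` evaluated at `(u, θ')` is `ℓ` at `u`. [folklore] -/
theorem eval_embedU (ℓ : LinF 192) (u : Fin 192 → ℚ) (θ' : Fin 3 → ℚ) :
    LinF.eval (embedU ℓ) (joinUT u θ') = LinF.eval ℓ u := by
  induction ℓ with
  | nil => simp [embedU]
  | cons p t ih =>
    simp only [embedU, List.map_cons, LinF.eval_cons] at ih ⊢
    rw [ih]
    have : joinUT u θ' (Fin.castLE (by omega) p.1) = u p.1 := by
      unfold joinUT
      rw [dif_pos (by simp [p.1.isLt])]
      rfl
    rw [this]

/-- `thetaVar k` evaluated at `(u, θ')` is `θ'_k`. [folklore] -/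
theorem eval_thetaVar (k : Fin 3) (u : Fin 192 → ℚ) (θ' : Fin 3 → ℚ) :
    LinF.eval (thetaVar k) (joinUT u θ') = θ' k := by
  rw [thetaVar, LinF.eval_coord]
  unfold joinUT
  have hk : ¬ ((⟨192 + k.val, by omega⟩ : Fin 195).val < 192) := by simp
  rw [dif_neg hk]
  have e : (⟨(⟨192 + k.val, by omega⟩ : Fin 195).val - 192, by omega⟩ : Fin 3) = k := Fin.ext (by simp)
  rw [e]

/-- The model misfit in terms of the model's functionals: `Σ_s Σ_c g_c · (resid (thetaList p) p (p+s) (V s) c)(u)²`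
(independent of `θ'`). [folklore] -/
theorem eval_lsModel_term (p : Site) (s : Off) (c : Fin 3) (u : Fin 192 → ℚ) (θ' : Fin 3 → ℚ) :
    LinF.eval (embedU (resid (thetaList p) p (tadd p s) (V (parity p) s) c)) (joinUT u θ') =
      LinF.eval (resid (thetaList p) p (tadd p s) (V (parity p) s) c) u :=
  eval_embedU _ u θ'

/-! ## The two misfit forms -/

/-- Misfit of the MODEL's chart: `Σ_s Σ_c g_c (u_{p+s} − u_p − W_p(u)·V s)_c²` as terms in `(u, θ')` (θ' unused). [folklore] -/
def lsModelTerms (p : Site) : List (Term 195) :=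
  let b := parity p
  let ths := thetaList p
  (shell b).flatMap fun s => [(0 : Fin 3), 1, 2].map fun c =>
    (gW c, embedU (resid ths p (tadd p s) (V b s) c), embedU (resid ths p (tadd p s) (V b s) c))

/-- The residual `(u_{p+s} − u_p − G⁻¹ C_{V s} θ')_c` for a FREE rotation parameter `θ'`. [folklore] -/
def freeResid (p : Site) (s : Off) (c : Fin 3) : LinF 195 :=
  let y := V (parity p) s
  (embedU (eRel p (tadd p s) c)).sub
    ((LinF.smul (Cmat y c 0 / gW c) (thetaVar 0)).add ((LinF.smul (Cmat y c 1 / gW c) (thetaVar 1)).add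
      (LinF.smul (Cmat y c 2 / gW c) (thetaVar 2))))

/-- The free misfit's residual in plain terms: `(u_{p+s} − u_p)_c − (Σ_k C_{V s}[c][k] θ'_k) / g_c`. [folklore] -/
theorem eval_freeResid (p : Site) (s : Off) (c : Fin 3) (u : Fin 192 → ℚ) (θ' : Fin 3 → ℚ) :
    LinF.eval (freeResid p s c) (joinUT u θ') =
      LinF.eval (eRel p (tadd p s) c) u - (Cmat (V (parity p) s) c 0 / gW c * θ' 0 +
        (Cmat (V (parity p) s) c 1 / gW c * θ' 1 + Cmat (V (parity p) s) c 2 / gW c * θ' 2)) := by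
  simp only [freeResid, LinF.eval_sub, LinF.eval_add, LinF.eval_smul, eval_embedU, eval_thetaVar]

/-- Misfit of an ARBITRARY skew map `G⁻¹ Σ θ'_k E_k`: `Σ_s Σ_c g_c (u_{p+s} − u_p − G⁻¹ C_{V s} θ')_c²`. [folklore] -/
def lsFreeTerms (p : Site) : List (Term 195) :=
  (shell (parity p)).flatMap fun s => [(0 : Fin 3), 1, 2].map fun c => (gW c, freeResid p s c, freeResid p s c)

/-- Model misfit at `u` (the value does not depend on `θ'`). [folklore] -/
def shellMisfitModel (p : Site) (u : Fin 192 → ℚ) (θ' : Fin 3 → ℚ) : ℚ := evalQ (lsModelTerms p) (joinUT u θ')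
/-- Misfit of the skew map with parameters `θ'` at `u`. [folklore] -/
def shellMisfitFree (p : Site) (u : Fin 192 → ℚ) (θ' : Fin 3 → ℚ) : ℚ := evalQ (lsFreeTerms p) (joinUT u θ')

/-- The difference form `free − model`, assembled and symmetrised (195 × 195, rank 3), parity A. -/
def lsMatA : Matrix (Fin 195) (Fin 195) ℚ := symm (assemble (lsFreeTerms siteA ++ negTermsN (lsModelTerms siteA))).toMatrix
/-- The difference form, parity B. -/
def lsMatB : Matrix (Fin 195) (Fin 195) ℚ := symm (assemble (lsFreeTerms siteB ++ negTermsN (lsModelTerms siteB))).toMatrix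

/-- Exact `LDLᵀ` certificate (computed in Lean) that `lsMatA ⪰ 0`.  COMPUTATIONAL (`native_decide`). -/
theorem lsCertA : PSD.LDLCert lsMatA := by
  native_decide

/-- Exact `LDLᵀ` certificate that `lsMatB ⪰ 0`.  COMPUTATIONAL (`native_decide`). -/
theorem lsCertB : PSD.LDLCert lsMatB := by
  native_decide

/-- **The model's co-rotation is the least-squares skew fit, A site**: for every `u` and every rotation parameter `θ'`,
`Σ_s‖e_s − W_p(u)V s‖²_G ≤ Σ_s‖e_s − G⁻¹C_{Vs}θ'‖²_G` (first clause of `CoreJointSiteIneq` for the finite model). -/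
theorem shellMisfit_le_A (u : Fin 192 → ℚ) (θ' : Fin 3 → ℚ) :
    shellMisfitModel siteA u θ' ≤ shellMisfitFree siteA u θ' := by
  have h := evalQ_nonneg_of_ldlCert (ts := lsFreeTerms siteA ++ negTermsN (lsModelTerms siteA)) rfl lsCertA (joinUT u θ')
  rw [evalQ_append, evalQ_negTermsN] at h
  unfold shellMisfitModel shellMisfitFree
  linarith

/-- **The model's co-rotation is the least-squares skew fit, B site.** -/
theorem shellMisfit_le_B (u : Fin 192 → ℚ) (θ' : Fin 3 → ℚ) :
    shellMisfitModel siteB u θ' ≤ shellMisfitFree siteB u θ' := by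
  have h := evalQ_nonneg_of_ldlCert (ts := lsFreeTerms siteB ++ negTermsN (lsModelTerms siteB)) rfl lsCertB (joinUT u θ')
  rw [evalQ_append, evalQ_negTermsN] at h
  unfold shellMisfitModel shellMisfitFree
  linarith

end Summit.AtomisticToContinuum.Crystallization.Theorems.StrictSplittingRuleTorusLMI
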